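import Summits.Ventures.Crystal3D.Kissing125.GSearchSearch3
import Summits.Ventures.Crystal3D.Kissing125.GSearchRoot3
import HarnessLib

/-!
# Root normalisation and the conclusion from the parts, κ-generic — part 4/4

HONEST FRAMING (cell pub-crystal3d, K-path at `h = 5/4`, V4 = κ as an explicit parameter): this is NOT a result printed
by Hales; it is his METHOD (arXiv:1209.6043, Theorem 3 + Lemmas 7–10, in the tree's form of a verified interval-arithmetic
growth search, `Literature/…/KissingSearch*.lean`) with the largest long-side cosine `κ` made an EXPLICIT PARAMETER
(`κ : Kappa`, carrying the two numeric facts the soundness proof uses: `-1/2 ≤ κ`, `κ < 1/4`).  Only the declarations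
whose statement depends on `κ` are declared here (namespace `…Kissing125.GSearch`, the tree's short names, no renames);
every κ-free helper is the landed K25 copy (`…Kissing125.KissingSearch.*`) and every κ-free lemma is cited from the tree
(PRIVATE per-file citation aliases; `GSearchTransport.lean` holds `toT : St → tree St` and the transport equalities).  The K25
instance is `κ25 = ⟨7/32, …⟩`; `GSearchBridge.lean` identifies the generic checker at
`κ25` with the landed `Kissing125.KissingSearch.checkPart`, so the landed run files are consumed unchanged.  Generated by
`HOME/lean/kissing125/v4-prep/gen/mkgen.py`; nothing here is asserted about GAP(1.26) or any census.

THIS FILE: the κ-tainted declarations of `Literature/Geometry/DiscreteGeometry/KissingSearchRoot.lean` (part 4 of 4), with `κ : Kappa` threaded; κ-free declarations of that file are NOT re-declared publicly (the κ-free helpers are the landed K25 copies; the κ-free tree lemmas used by the proofs are cited through PRIVATE aliases at the top of the file).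

## References
* T. C. Hales, *A proof of Fejes Tóth's conjecture on sphere packings with kissing number twelve*,
  arXiv:1209.6043 (2012): Definition 1, Theorem 2, Theorem 3, Lemmas 7–10. [`Hales2012`]
* R. E. Moore, *Interval Analysis* (1966), Theorem 3.1, §4.4. [`Moore1966`]
-/

namespace Summit.Ventures.Crystal3D.Kissing125

open Literature.Geometry.DiscreteGeometry
open Summit.Ventures.Crystal3D.Kissing125.KissingSearch

namespace GSearch

open Real Literature.Analysis.ValidatedNumerics KissingLP NonemptyInterval Finset

variable {κ : Kappa}

/-! ### κ-free tree lemmas used below, read over the K25 copies (PRIVATE citation aliases; the public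
surface of this file is κ-generic only) -/

/-- K25 reading of the tree lemma `lt_of_mem_tset` (κ-free; proof = citation of the tree lemma). [folklore] -/
private theorem lt_of_mem_tset {t v : ℕ} (ht : TriValid t) (hv : v ∈ tset t) : v < 12 :=
  Literature.Geometry.DiscreteGeometry.KissingSearch.lt_of_mem_tset ht hv

/-- K25 reading of the tree lemma `mkRoot_gdom` (κ-free; proof = citation of the tree lemma). [folklore] -/
private theorem mkRoot_gdom (m : ℕ) :
  m < 2 → ∀ bits < 16, ∀ i < 144, (mkRoot m bits).dom.getD i UNL = rootDomIdx m bits i :=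
  by
  intro hm bits hb i hi
  have h := Literature.Geometry.DiscreteGeometry.KissingSearch.mkRoot_gdom m hm bits hb i hi
  rw [← mkRoot_tr, toT_dom] at h
  exact h

/-- K25 reading of the tree lemma `mkRoot_gsc` (κ-free; proof = citation of the tree lemma). [folklore] -/
private theorem mkRoot_gsc (m : ℕ) :
  m < 2 →
    ∀ bits < 16,
      ∀ p < 12,
        ∀ q < 12,
          p ≠ q →
            (mkRoot m bits).gsc p q = (List.filter (fun t ↦ tmem t p && tmem t q) (mkRoot m bits).tris.toList).length :=
  by
  intro hm bits hb p hp q hq hpq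
  have h := Literature.Geometry.DiscreteGeometry.KissingSearch.mkRoot_gsc m hm bits hb p hp q hq hpq
  rw [← mkRoot_tr, toT_gsc, toT_tris] at h
  exact h

/-- K25 reading of the tree lemma `mkRoot_sizes` (κ-free; proof = citation of the tree lemma). [folklore] -/
private theorem mkRoot_sizes (m : ℕ) :
  m < 2 → ∀ bits < 16, (mkRoot m bits).dom.size = 144 ∧ (mkRoot m bits).sc.size = 144 :=
  by
  intro hm bits hb
  have h := Literature.Geometry.DiscreteGeometry.KissingSearch.mkRoot_sizes m hm bits hb
  rw [← mkRoot_tr, toT_dom, toT_sc] at h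
  exact h

/-- K25 reading of the tree lemma `mkRoot_tris` (κ-free; proof = citation of the tree lemma). [folklore] -/
private theorem mkRoot_tris (m bits : ℕ) :
  (mkRoot m bits).tris = #[triCode 0 1 2, triCode 0 1 3, triCode 0 2 4] :=
  by
  have h := Literature.Geometry.DiscreteGeometry.KissingSearch.mkRoot_tris m bits
  rw [← mkRoot_tr, toT_tris] at h
  exact h

/-- K25 reading of the tree lemma `root_codes` (κ-free; proof = citation of the tree lemma). [folklore] -/
private theorem root_codes :
  (TriValid (triCode 0 1 2) ∧ tset (triCode 0 1 2) = {0, 1, 2}) ∧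
    (TriValid (triCode 0 1 3) ∧ tset (triCode 0 1 3) = {0, 1, 3}) ∧
      TriValid (triCode 0 2 4) ∧ tset (triCode 0 2 4) = {0, 2, 4} :=
  Literature.Geometry.DiscreteGeometry.KissingSearch.root_codes

/-- K25 reading of the tree lemma `sIdx_eq_iff` (κ-free; proof = citation of the tree lemma). [folklore] -/
private theorem sIdx_eq_iff {a b a' b' : ℕ} (ha : a < 12) (hb : b < 12)
  (ha' : a' < 12) (hb' : b' < 12) : sIdx a b = sIdx a' b' ↔ a = a' ∧ b = b' ∨ a = b' ∧ b = a' :=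
  Literature.Geometry.DiscreteGeometry.KissingSearch.sIdx_eq_iff ha hb ha' hb'

/-- K25 reading of the tree lemma `sIdx_lt` (κ-free; proof = citation of the tree lemma). [folklore] -/
private theorem sIdx_lt {a b : ℕ} (ha : a < 12) (hb : b < 12) : sIdx a b < 144 :=
  Literature.Geometry.DiscreteGeometry.KissingSearch.sIdx_lt ha hb


section Main
variable {M : KConf κ}
/-- **The root state of a structure in good position is realized by it.** [folklore] -/
theorem realizes_mkRoot {M : KConf κ} (G : M.Good 0 1 2 3 4) : Realizes M (mkRoot (M.ty 1 2) (bitsOf M)) := by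
  classical
  obtain ⟨-, -, -, -, -, -, -, -, -, -, -, -, -, -, -, g1, g2, T1, T2, T3, -, -⟩ := G
  have hm : M.ty 1 2 < 2 := by have := M.ty_le_one 1 2; omega
  obtain ⟨d1, d2, d3, d4, hb⟩ := bitsOf_decode M
  obtain ⟨hszd, hszs⟩ := mkRoot_sizes _ hm _ hb
  obtain ⟨⟨v1, s1⟩, ⟨v2, s2⟩, ⟨v3, s3⟩⟩ := root_codes
  have htris : (mkRoot (M.ty 1 2) (bitsOf M)).tris.toList = [triCode 0 1 2, triCode 0 1 3, triCode 0 2 4] := by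
    rw [mkRoot_tris]
  -- domains
  have hgd : ∀ p q, p < 12 → q < 12 →
      (mkRoot (M.ty 1 2) (bitsOf M)).gdom p q = rootDomIdx (M.ty 1 2) (bitsOf M) (sIdx p q) := by
    intro p q hp hq
    have h := mkRoot_gdom _ hm _ hb _ (sIdx_lt hp hq)
    unfold St.gdom
    exact h
  -- the meaning of the root domain at a pair
  have sem : ∀ p q, p < 12 → q < 12 → p ≠ q →
      DomSem κ (rootDomIdx (M.ty 1 2) (bitsOf M) (sIdx p q)) (M.g p q) ∧
      (rootDomIdx (M.ty 1 2) (bitsOf M) (sIdx p q) ≠ UNL →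
        ∃ t ∈ [triCode 0 1 2, triCode 0 1 3, triCode 0 2 4], p ∈ tset t ∧ q ∈ tset t) := by
    intro p q hp hq hpq
    unfold rootDomIdx
    simp only [d1, d2, d3, d4]
    have e01 := sIdx_eq_iff hp hq (by norm_num : 0 < 12) (by norm_num : 1 < 12)
    have e02 := sIdx_eq_iff hp hq (by norm_num : 0 < 12) (by norm_num : 2 < 12)
    have e12 := sIdx_eq_iff hp hq (by norm_num : 1 < 12) (by norm_num : 2 < 12)
    have e03 := sIdx_eq_iff hp hq (by norm_num : 0 < 12) (by norm_num : 3 < 12)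
    have e13 := sIdx_eq_iff hp hq (by norm_num : 1 < 12) (by norm_num : 3 < 12)
    have e04 := sIdx_eq_iff hp hq (by norm_num : 0 < 12) (by norm_num : 4 < 12)
    have e24 := sIdx_eq_iff hp hq (by norm_num : 2 < 12) (by norm_num : 4 < 12)
    -- membership in a root triangle from the pair
    have side : ∀ {a b : ℕ} {t : ℕ}, tset t = ({0, a, b} : Finset ℕ) →
        ((p = 0 ∧ q = a ∨ p = a ∧ q = 0) ∨ (p = 0 ∧ q = b ∨ p = b ∧ q = 0) ∨ (p = a ∧ q = b ∨ p = b ∧ q = a)) →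
        p ∈ tset t ∧ q ∈ tset t := by
      intro a b t ht h
      rw [ht]
      simp only [Finset.mem_insert, Finset.mem_singleton]
      omega
    -- the contact or long code of a side of a triangle of `M`
    have lab : ∀ {a b : ℕ} {t : Finset ℕ}, t ∈ M.T → a ∈ t → b ∈ t → a < 12 → b < 12 → a ≠ b →
        ((p = a ∧ q = b) ∨ (p = b ∧ q = a)) → DomSem κ (if M.ty a b = 0 then 0 else FULLR) (M.g p q) := by
      intro a b t hT hat hbt ha hb' hab h
      rcases h with ⟨rfl, rfl⟩ | ⟨rfl, rfl⟩
      · exact domSem_lab M ha hb' hab hT hat hbt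
      · rw [M.g_symm]; exact domSem_lab M ha hb' hab hT hat hbt
    by_cases c01 : sIdx p q = sIdx 0 1
    · rw [if_pos c01]
      refine ⟨?_, fun _ => ⟨triCode 0 1 2, by simp, side s1 (Or.inl (e01.1 c01))⟩⟩
      rcases e01.1 c01 with ⟨rfl, rfl⟩ | ⟨rfl, rfl⟩
      · exact Or.inr (Or.inl ⟨rfl, g1⟩)
      · exact Or.inr (Or.inl ⟨rfl, by rw [M.g_symm]; exact g1⟩)
    rw [if_neg c01]
    by_cases c02 : sIdx p q = sIdx 0 2
    · rw [if_pos c02]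
      refine ⟨?_, fun _ => ⟨triCode 0 1 2, by simp, side s1 (Or.inr (Or.inl (e02.1 c02)))⟩⟩
      rcases e02.1 c02 with ⟨rfl, rfl⟩ | ⟨rfl, rfl⟩
      · exact Or.inr (Or.inl ⟨rfl, g2⟩)
      · exact Or.inr (Or.inl ⟨rfl, by rw [M.g_symm]; exact g2⟩)
    rw [if_neg c02]
    by_cases c12 : sIdx p q = sIdx 1 2
    · rw [if_pos c12]
      exact ⟨lab T1 (by simp) (by simp) (by norm_num) (by norm_num) (by norm_num) (e12.1 c12),
        fun _ => ⟨triCode 0 1 2, by simp, side s1 (Or.inr (Or.inr (e12.1 c12)))⟩⟩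
    rw [if_neg c12]
    by_cases c03 : sIdx p q = sIdx 0 3
    · rw [if_pos c03]
      exact ⟨lab T2 (by simp) (by simp) (by norm_num) (by norm_num) (by norm_num) (e03.1 c03),
        fun _ => ⟨triCode 0 1 3, by simp, side s2 (Or.inr (Or.inl (e03.1 c03)))⟩⟩
    rw [if_neg c03]
    by_cases c13 : sIdx p q = sIdx 1 3
    · rw [if_pos c13]
      exact ⟨lab T2 (by simp) (by simp) (by norm_num) (by norm_num) (by norm_num) (e13.1 c13),
        fun _ => ⟨triCode 0 1 3, by simp, side s2 (Or.inr (Or.inr (e13.1 c13)))⟩⟩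
    rw [if_neg c13]
    by_cases c04 : sIdx p q = sIdx 0 4
    · rw [if_pos c04]
      exact ⟨lab T3 (by simp) (by simp) (by norm_num) (by norm_num) (by norm_num) (e04.1 c04),
        fun _ => ⟨triCode 0 2 4, by simp, side s3 (Or.inr (Or.inl (e04.1 c04)))⟩⟩
    rw [if_neg c04]
    by_cases c24 : sIdx p q = sIdx 2 4
    · rw [if_pos c24]
      exact ⟨lab T3 (by simp) (by simp) (by norm_num) (by norm_num) (by norm_num) (e24.1 c24),
        fun _ => ⟨triCode 0 2 4, by simp, side s3 (Or.inr (Or.inr (e24.1 c24)))⟩⟩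
    rw [if_neg c24]
    exact ⟨Or.inl rfl, fun h => absurd rfl h⟩
  -- codes of the seven sides are not `UNL`
  have labne : ∀ t, (if t = 0 then 0 else FULLR) ≠ UNL := by
    intro t; split_ifs <;> decide
  have ne_of : ∀ i, (i = sIdx 0 1 ∨ i = sIdx 0 2 ∨ i = sIdx 1 2 ∨ i = sIdx 0 3 ∨ i = sIdx 1 3 ∨ i = sIdx 0 4 ∨
      i = sIdx 2 4) → rootDomIdx (M.ty 1 2) (bitsOf M) i ≠ UNL := by
    have h0 : (0 : ℕ) ≠ UNL := by decide
    intro i hi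
    unfold rootDomIdx
    simp only
    rcases hi with rfl | rfl | rfl | rfl | rfl | rfl | rfl
    · rw [if_pos rfl]
      exact h0
    · rw [if_neg (show ¬ (sIdx 0 2 = sIdx 0 1) by decide), if_pos rfl]
      exact h0
    · rw [if_neg (show ¬ (sIdx 1 2 = sIdx 0 1) by decide), if_neg (show ¬ (sIdx 1 2 = sIdx 0 2) by decide), if_pos rfl]
      exact labne _
    · rw [if_neg (show ¬ (sIdx 0 3 = sIdx 0 1) by decide), if_neg (show ¬ (sIdx 0 3 = sIdx 0 2) by decide), if_neg (show ¬ (sIdx 0 3 = sIdx 1 2) by decide), if_pos rfl]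
      exact labne _
    · rw [if_neg (show ¬ (sIdx 1 3 = sIdx 0 1) by decide), if_neg (show ¬ (sIdx 1 3 = sIdx 0 2) by decide), if_neg (show ¬ (sIdx 1 3 = sIdx 1 2) by decide), if_neg (show ¬ (sIdx 1 3 = sIdx 0 3) by decide), if_pos rfl]
      exact labne _
    · rw [if_neg (show ¬ (sIdx 0 4 = sIdx 0 1) by decide), if_neg (show ¬ (sIdx 0 4 = sIdx 0 2) by decide), if_neg (show ¬ (sIdx 0 4 = sIdx 1 2) by decide), if_neg (show ¬ (sIdx 0 4 = sIdx 0 3) by decide), if_neg (show ¬ (sIdx 0 4 = sIdx 1 3) by decide), if_pos rfl]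
      exact labne _
    · rw [if_neg (show ¬ (sIdx 2 4 = sIdx 0 1) by decide), if_neg (show ¬ (sIdx 2 4 = sIdx 0 2) by decide), if_neg (show ¬ (sIdx 2 4 = sIdx 1 2) by decide), if_neg (show ¬ (sIdx 2 4 = sIdx 0 3) by decide), if_neg (show ¬ (sIdx 2 4 = sIdx 1 3) by decide), if_neg (show ¬ (sIdx 2 4 = sIdx 0 4) by decide), if_pos rfl]
      exact labne _
  exact {
    size_dom := hszd
    size_sc := hszs
    valid := by
      intro t ht; rw [htris] at ht
      simp only [List.mem_cons, List.not_mem_nil, or_false] at ht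
      rcases ht with rfl | rfl | rfl
      · exact v1
      · exact v2
      · exact v3
    mem := by
      intro t ht; rw [htris] at ht
      simp only [List.mem_cons, List.not_mem_nil, or_false] at ht
      rcases ht with rfl | rfl | rfl
      · rw [s1]; exact T1
      · rw [s2]; exact T2
      · rw [s3]; exact T3
    nodup := by rw [htris]; decide
    sc_eq := fun p q hp hq hpq => mkRoot_gsc _ hm _ hb p hp q hq hpq
    dom := fun p q hp hq hpq => by rw [hgd p q hp hq]; exact (sem p q hp hq hpq).1
    lab_side := fun p q hp hq hpq hl => by
      rw [hgd p q hp hq] at hl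
      obtain ⟨t, ht, hpt, hqt⟩ := (sem p q hp hq hpq).2 hl
      exact ⟨t, by rw [htris]; exact ht, hpt, hqt⟩
    side_lab := by
      intro t ht p hp q hq hpq
      rw [htris] at ht
      simp only [List.mem_cons, List.not_mem_nil, or_false] at ht
      have hp12 : p < 12 := by
        rcases ht with rfl | rfl | rfl
        · exact lt_of_mem_tset v1 hp
        · exact lt_of_mem_tset v2 hp
        · exact lt_of_mem_tset v3 hp
      have hq12 : q < 12 := by
        rcases ht with rfl | rfl | rfl
        · exact lt_of_mem_tset v1 hq
        · exact lt_of_mem_tset v2 hq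
        · exact lt_of_mem_tset v3 hq
      rw [hgd p q hp12 hq12]
      apply ne_of
      rcases ht with rfl | rfl | rfl
      · rw [s1] at hp hq; simp only [Finset.mem_insert, Finset.mem_singleton] at hp hq
        rcases hp with rfl | rfl | rfl <;> rcases hq with rfl | rfl | rfl <;> first | exact absurd rfl hpq | decide
      · rw [s2] at hp hq; simp only [Finset.mem_insert, Finset.mem_singleton] at hp hq
        rcases hp with rfl | rfl | rfl <;> rcases hq with rfl | rfl | rfl <;> first | exact absurd rfl hpq | decide
      · rw [s3] at hp hq; simp only [Finset.mem_insert, Finset.mem_singleton] at hp hq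
        rcases hp with rfl | rfl | rfl <;> rcases hq with rfl | rfl | rfl <;> first | exact absurd rfl hpq | decide }

/-- Under the root normalisation, the parameters read off `M` are admissible. [folklore] -/
theorem rootOK_bitsOf {M : KConf κ} (G : M.Good 0 1 2 3 4) (hI : M.RootInv) : rootOK (bitsOf M) = true := by
  obtain ⟨-, -, -, -, -, -, -, -, -, -, -, -, -, -, -, -, -, T1, T2, T3, -, hpair⟩ := G
  obtain ⟨d1, d2, d3, d4, hb⟩ := bitsOf_decode M
  unfold rootOK
  simp only [d1, d2, d3, d4]
  -- not two long spokes
  have nll : ¬ (M.ty 0 3 = 1 ∧ M.ty 0 4 = 1) := by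
    rintro ⟨h3, h4⟩
    unfold KConf.ty at h3 h4
    split_ifs at h3 with g3
    split_ifs at h4 with g4
    have long_of : ∀ {x : ℕ} {t : Finset ℕ}, t ∈ M.T → (0 : ℕ) ∈ t → x ∈ t → x ≠ 0 → M.g 0 x ≠ 1 / 2 →
        ({0, x} : Finset ℕ) ∈ M.longSides := by
      intro x t ht h0t hxt hx0 hg
      unfold KConf.longSides
      rw [Finset.mem_filter, KConf.mem_sides]
      refine ⟨⟨by rw [Finset.card_pair (Ne.symm hx0)], t, ht, ?_⟩, 0, by simp, x, by simp, Ne.symm hx0, hg⟩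
      intro y hy; simp only [Finset.mem_insert, Finset.mem_singleton] at hy
      rcases hy with rfl | rfl
      · exact h0t
      · exact hxt
    have l3 := long_of T2 (by simp) (by simp) (by norm_num) g3
    have l4 := long_of T3 (by simp) (by simp) (by norm_num) g4
    exact absurd (hpair 3 4 l3 l4) (by norm_num)
  have htb := hI.2.2
  have t03 := M.ty_le_one 0 3; have t13 := M.ty_le_one 1 3; have t04 := M.ty_le_one 0 4; have t24 := M.ty_le_one 2 4
  simp only [Bool.and_eq_true, Bool.not_eq_true', Bool.and_eq_false_iff, beq_eq_false_iff_ne, ne_eq, Bool.or_eq_false_iff,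
    decide_eq_false_iff_not, not_lt]
  omega

/-- The root state of `M` is among the root states. [folklore] -/
theorem mem_rootStates {M : KConf κ} (G : M.Good 0 1 2 3 4) (hI : M.RootInv) :
    (mkRoot (M.ty 1 2) (bitsOf M), [0, 1, 2, 3, 4]) ∈ rootStates := by
  unfold rootStates
  rw [List.mem_flatMap]
  have hm : M.ty 1 2 < 2 := by have := M.ty_le_one 1 2; omega
  obtain ⟨-, -, -, -, hb⟩ := bitsOf_decode M
  refine ⟨M.ty 1 2, List.mem_range.2 hm, ?_⟩
  rw [List.mem_map]
  exact ⟨bitsOf M, List.mem_filter.2 ⟨List.mem_range.2 hb, rootOK_bitsOf G hI⟩, rfl⟩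

/-- **The main abstract theorem.**  If every root state searches `true` (with some fuel), every
structure `M : KConf` has an FCC or HCP contact graph. [cite: Hales2012, Theorem 3 and Lemma 9] -/
theorem concl_of_roots {fuel : ℕ} (h : ∀ p ∈ rootStates, St.search κ p.1 p.2 fuel = true) (M : KConf κ) : M.Concl := by
  obtain ⟨M', hback, G, hI⟩ := M.exists_good_rootInv
  apply hback
  have hmem := mem_rootStates G hI
  have hR := realizes_mkRoot G
  refine search_sound fuel M' _ [0, 1, 2, 3, 4] hR hI (fun x hx => ?_) (h _ hmem)
  -- the labels `0 … 4` are used in the root state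
  rw [mkRoot_tris]
  obtain ⟨⟨-, s1⟩, ⟨-, s2⟩, ⟨-, s3⟩⟩ := root_codes
  interval_cases x
  · exact ⟨triCode 0 1 2, by simp, by rw [s1]; simp⟩
  · exact ⟨triCode 0 1 2, by simp, by rw [s1]; simp⟩
  · exact ⟨triCode 0 1 2, by simp, by rw [s1]; simp⟩
  · exact ⟨triCode 0 1 3, by simp, by rw [s2]; simp⟩
  · exact ⟨triCode 0 2 4, by simp, by rw [s3]; simp⟩

/-- **The main abstract theorem from the parts of the computation.** [folklore] -/
theorem concl_of_parts {depth parts fuel : ℕ} (hparts : 0 < parts)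
    (h : ∀ i, i < parts → checkPart κ depth parts i fuel = true) (M : KConf κ) : M.Concl :=
  concl_of_roots (search_roots_of_parts hparts h) M

end Main


end GSearch

end Summit.Ventures.Crystal3D.Kissing125
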